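import Mathlib.Probability.Martingale.Convergence
import Mathlib.MeasureTheory.Integral.DominatedConvergence
import Literature.Probability.LatticeModels.ReflectionPositivity
import Literature.Analysis.FunctionSpaces.WeakCompactnessL1Proofs
import HarnessLib

/-!
# Bounded observables of a countable product are `L²`-limits of bounded LOCAL observables

Theorem-only file (no definitions, no named facts).  For a probability measure `μ` on configurations `V → S` (`V` countable, `S` any measurable space) and a set of
sites `P`, every BOUNDED real observable `F` measurable in the coordinates in `P` (`positiveEvents P` = Mathlib's `cylinderEvents P`) is approximated in `L²(μ)` by bounded
observables measurable in FINITELY many coordinates in `P`, with the same bound: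

* `exists_local_bdd_integral_sq_sub_lt` — for `δ > 0` there are a finite window `W ⊆ P` and `G` measurable in the coordinates in `W` with `|G| ≤ C` and `∫ (F − G)² dμ < δ`.

Proof: Lévy's upward theorem along `σ(coordinates in W_n)`, `W_n ↑ P` finite (Mathlib `Integrable.tendsto_ae_condExp`), truncation of the conditional expectations at
`C` (they are bounded by `C` only a.e.), dominated convergence for `(F − G_n)²`.  This is the «`𝓔₊` is generated by the local (time-zero-slab ∕ cylinder) observables» step of the
Osterwalder–Schrader reconstruction (Glimm–Jaffe 1987 §6.1) and the companion of `ReflectionPositivityExtensionCountable.lean` (same approximants).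

## References
* J. Glimm, A. Jaffe, *Quantum Physics* (2nd ed. 1987), §6.1 (`𝓔₊` and its generating subalgebras). [GlimmJaffe1987]
* M. Biskup, LNM 1970 (2009), §5.1 (local observables). [Biskup2009]
-/

noncomputable section

open MeasureTheory Filter
open scoped Topology

namespace Literature.Probability.LatticeModels

open Literature.Analysis.FunctionSpaces (abs_max_neg_min_le max_neg_min_eq_self)

variable {V S : Type*} [MeasurableSpace S]

/-- ★ **BOUNDED OBSERVABLES ARE `L²`-LIMITS OF BOUNDED LOCAL OBSERVABLES** (countable index set, any single-spin space): if `F` is measurable in the coordinates in `P`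
with `|F| ≤ C`, then for every `δ > 0` there are a finite window `W ⊆ P` and an observable `G` measurable in the coordinates in `W`, `|G| ≤ C`, with `∫ (F − G)² dμ < δ`.
[cite: GlimmJaffe1987, §6.1 (generation of 𝓔₊ by local observables)] [cite: Biskup2009, §5.1] -/
theorem exists_local_bdd_integral_sq_sub_lt [Countable V] {μ : Measure (V → S)} [IsProbabilityMeasure μ] {P : Set V} {F : (V → S) → ℝ}
    (hF : Measurable[positiveEvents (S := S) P] F) {C : ℝ} (hC : 0 ≤ C) (hFb : ∀ σ, |F σ| ≤ C) {δ : ℝ} (hδ : 0 < δ) :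
    ∃ W : Finset V, (↑W : Set V) ⊆ P ∧ ∃ G : (V → S) → ℝ,
      Measurable[cylinderEvents (X := fun _ : V => S) ↑W] G ∧ (∀ σ, |G σ| ≤ C) ∧ ∫ σ, (F σ - G σ) ^ 2 ∂μ < δ := by
  classical
  -- enumerate `V` and define the finite windows `W n = {v ∈ P | #v < n}`
  obtain ⟨num, hnum⟩ := Countable.exists_injective_nat V
  let W : ℕ → Finset V := fun n => ((Finset.range n).preimage num (hnum.injOn)).filter fun v => v ∈ P
  have hWP : ∀ n, (↑(W n) : Set V) ⊆ P := fun n x hx => by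
    simp only [W, Finset.coe_filter, Set.mem_setOf_eq] at hx
    exact hx.2
  have hWmono : ∀ m n, m ≤ n → (↑(W m) : Set V) ⊆ ↑(W n) := fun m n hmn x hx => by
    simp only [W, Finset.coe_filter, Finset.mem_preimage, Finset.mem_range, Set.mem_setOf_eq] at hx ⊢
    exact ⟨lt_of_lt_of_le hx.1 hmn, hx.2⟩
  let ℱ : Filtration ℕ (MeasurableSpace.pi : MeasurableSpace (V → S)) :=
    { seq := fun n => cylinderEvents (X := fun _ : V => S) ↑(W n)
      mono' := fun m n hmn => cylinderEvents_mono (hWmono m n hmn)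
      le' := fun _ => cylinderEvents_le_pi }
  have hsup : positiveEvents (S := S) P ≤ ⨆ n, (ℱ n : MeasurableSpace (V → S)) := by
    refine iSup₂_le fun x hx => ?_
    have hxW : x ∈ (↑(W (num x + 1)) : Set V) := by
      simp only [W, Finset.coe_filter, Finset.mem_preimage, Finset.mem_range, Set.mem_setOf_eq]
      exact ⟨Nat.lt_succ_self _, hx⟩
    calc MeasurableSpace.comap (fun σ : V → S => σ x) inferInstance
        ≤ (ℱ (num x + 1) : MeasurableSpace (V → S)) := le_iSup₂_of_le x hxW le_rfl
      _ ≤ ⨆ n, (ℱ n : MeasurableSpace (V → S)) := le_iSup (fun n => (ℱ n : MeasurableSpace (V → S))) (num x + 1)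
  have hFpi : Measurable F := hF.mono cylinderEvents_le_pi le_rfl
  have hFm' : StronglyMeasurable[⨆ n, (ℱ n : MeasurableSpace (V → S))] F := (hF.mono hsup le_rfl).stronglyMeasurable
  have hFint : Integrable F μ := Integrable.of_bound hFpi.aestronglyMeasurable C (ae_of_all _ fun σ => (Real.norm_eq_abs _).le.trans (hFb σ))
  -- the truncated conditional expectations
  set G : ℕ → (V → S) → ℝ := fun n => μ[F | ℱ n] with hGdef
  have hGm : ∀ n, Measurable[ℱ n] (G n) := fun n => (stronglyMeasurable_condExp (m := ℱ n) (μ := μ) (f := F)).measurable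
  set G' : ℕ → (V → S) → ℝ := fun n σ => max (-C) (min C (G n σ)) with hG'def
  have hG'm : ∀ n, Measurable[ℱ n] (G' n) := fun n =>
    (@measurable_const _ _ _ (ℱ n) (-C)).max ((@measurable_const _ _ _ (ℱ n) C).min (hGm n))
  have hG'mpi : ∀ n, Measurable (G' n) := fun n => (hG'm n).mono (ℱ.le n) le_rfl
  have hG'bdd : ∀ n σ, |G' n σ| ≤ C := fun n σ => abs_max_neg_min_le hC _
  -- a.e. convergence `G' n → F`
  have haeG : ∀ᵐ σ ∂μ, Tendsto (fun n => G n σ) atTop (𝓝 (F σ)) := hFint.tendsto_ae_condExp hFm'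
  have hGbdd : ∀ᵐ σ ∂μ, ∀ n, |G n σ| ≤ C := ae_all_iff.2 fun n => ae_bdd_abs_condExp_of_ae_bdd_abs (ae_of_all _ hFb)
  have hae : ∀ᵐ σ ∂μ, Tendsto (fun n => G' n σ) atTop (𝓝 (F σ)) := by
    filter_upwards [haeG, hGbdd] with σ h1 h2
    have heq : (fun n => G' n σ) = fun n => G n σ := funext fun n => max_neg_min_eq_self (h2 n)
    rw [heq]
    exact h1
  -- dominated convergence for `(F − G' n)²`
  have hlim : Tendsto (fun n => ∫ σ, (F σ - G' n σ) ^ 2 ∂μ) atTop (𝓝 (∫ σ, (F σ - F σ) ^ 2 ∂μ)) := by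
    refine tendsto_integral_of_dominated_convergence (fun _ => (C + C) ^ 2) (fun n => ?_) (integrable_const _) (fun n => ae_of_all _ fun σ => ?_) ?_
    · exact ((hFpi.sub (hG'mpi n)).pow_const 2).aestronglyMeasurable
    · rw [Real.norm_eq_abs, abs_pow, pow_le_pow_iff_left₀ (abs_nonneg _) (by linarith) two_ne_zero]
      exact (abs_sub _ _).trans (add_le_add (hFb σ) (hG'bdd n σ))
    · filter_upwards [hae] with σ h1
      exact ((tendsto_const_nhds.sub h1).pow 2)
  simp only [sub_self, ne_eq, OfNat.ofNat_ne_zero, not_false_eq_true, zero_pow, integral_zero] at hlim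
  obtain ⟨n, hn⟩ := (hlim.eventually (gt_mem_nhds hδ)).exists
  exact ⟨W n, hWP n, G' n, hG'm n, hG'bdd n, hn⟩

end Literature.Probability.LatticeModels
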